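/-
Origin: expansion seat `planner-pub-hodgecm-pv03-g6-0`, handover #4 2026-08-18T10:32:56Z (`HOME/pub-hodgecm-pv03-g6/lean/Pv03g6/G4FinalCM.lean`, md5 0d812cbf, 51 lines);
landed by the gen-7 packager in gate run 28 as `HodgeCM/Model/ToyG2/G4FinalCM.lean` (import ^import Pv03g6\.→import HodgeCM.Model.ToyG2. ×1; import ^import ToyG2\.→import HodgeCM.Model.ToyG2. ×1).
-/
/-
Copyright (c) 2026. All rights reserved.
Released under Apache 2.0 license as described in the file LICENSE.
-/
import Mathlib
import Summits.HodgeConjecture.HodgeCM.Model.ToyG2.RadicalProdStep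
import Summits.HodgeConjecture.HodgeCM.Model.ToyG2.G4WitnessCM

/-!
# ToyG2.G4FinalCM — the unconditional G4 consistency witness

Seat `planner-pub-hodgecm-pv03-g6-0` (DAG-node prover #03, gen 6).  One-line join of
* toy-g2's G1 theorem `radKilled_of_good` (`RadicalProdStep.lean`: the pulled-back surface trace kills the left
  radical, for all good `S`, `X`, `f`), and
* this seat's `g4_witness_of_g1` (`G4WitnessCM.lean`: the CM-good sub-universe `toyUniverseCM d t` of
  `toyUniverse₃ d t` satisfies all 28 model axioms given G1 — M26 by `hodgeRiesz_of_conjData` — and both realisation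
  inputs, transported from pv03-g5's `realisationExistsPerL₃/Face₃`).

Results (no hypotheses): **`g4_witnessCM : ∃ U : Universe, U.ModelAxioms ∧ U.RealisationExistsPerL ∧
U.RealisationExistsFace`**; `toyUniverseCM_modelAxioms' d t`; and in the model the package's end state
`endStateCM d t : 1 ≤ d → t ^ 2 = 16 → PerL ∧ PeriodThmF ∧ W_RK4` — i.e. the hypothesis structure
`ModelAxioms ∧ RealisationExistsPerL ∧ RealisationExistsFace` of the headline theorems is CONSISTENT (satisfiable by
an explicit finite-dimensional model), which is what the G4 charge of the toy lineage asks.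
-/

namespace HodgeCM.ToyG2

open HodgeCM.Toy
open Literature.AlgebraicGeometry.Motives

noncomputable section

/-- G1 for all good surfaces and targets (toy-g2, `radKilled_of_good`) in the shape `G1All` -/
theorem g1All_holds : G1All := fun _ _ f hS hX hS2 => radKilled_of_good hS hS2 hX f

/-- **all 28 model axioms hold in the CM-good toy universe**, unconditionally -/
theorem toyUniverseCM_modelAxioms' (d t : ℚ) : (toyUniverseCM d t).ModelAxioms :=
  toyUniverseCM_modelAxioms d t g1All_holds

/-- **the G4 consistency witness** (unconditional): a universe satisfying the model axioms and both realisation inputs -/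
theorem g4_witnessCM : ∃ U : Universe, U.ModelAxioms ∧ U.RealisationExistsPerL ∧ U.RealisationExistsFace :=
  g4_witness_of_g1 g1All_holds

/-- in the model `toyUniverseCM d t` (`1 ≤ d`, `t² = 16`): the package's end state `PerL ∧ PeriodThmF ∧ W_RK4` -/
theorem endStateCM (d t : ℚ) (hd : (1 : ℚ) ≤ d) (ht : t ^ 2 = 16) :
    (toyUniverseCM d t).PerL ∧ (toyUniverseCM d t).PeriodThmF ∧ (toyUniverseCM d t).W_RK4 :=
  endStateCM_of_g1 d t hd ht g1All_holds

end

end HodgeCM.ToyG2
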